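import Summits.QuantumFields.BalabanUV.T4Continuum.Support.B13KPStepTermWindow
import Summits.QuantumFields.BalabanUV.T4Continuum.Support.B13OpMeasurable

/-!
# NE5 ∕ U3, route P2 — REPAIR R-b OF GAPS G-ne5p2-5, part 3: route P2's END on Bałaban's carriers of record for term-format slots RUN ON THE
# MEASURABLE OPERATOR SLOT `measOp` — the same composition as `B13KPStepTermModel`∕`…Window`, with the unsatisfiable binder `Geometry` REPLACED
# by its lattice part `GeometryCore` + measurability side conditions of printed KIND (every displayed binder now satisfiable in principle)

Cell `pub-balaban`, unit `b2b-balaban-t4-ne5-p2` (NE5 ∕ U3 PROVER seat P2 «polymer-activity Lipschitz ∕ Kotecký–Preiss route», lineage gen 19).  Summits-side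
new work (cell bookkeeping; NOT a Literature module; nothing of the manuscripts is asserted).  HONEST FRAMING: rung (B)+1 of the FINITE-VOLUME T⁴
programme — NOT infinite volume, NOT mass gap, NOT Clay, **NOT A PROOF OF NE5** (spine 0∕9): an implication from displayed binders over
NAMED-PARAMETER cores and constants.  HONEST DEPENDENCY (cell line, verbatim): continuum YM on T⁴ ⇐ BetaPertH ∧ nine spine estimates (0/9 proved);
BetaPertH ⇐ (D1) ∧ (D4) ∧ CAP+tail; G-an2-4 gates asym, D1 and NE2/3/4.

WHAT.  For `𝔖 : TermSlots …` (leaf-08), constants `𝔡 Z ℓ`, and the measurable slot `M := measOp T κ ι Ω 𝒴` (part 2):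
* §1 `stepOnSub` — the step of record with its operator data COERCED into `M` (side condition: they lie in `M`; `opB_mem_measOp_of_raw` ∕
  `opA_mem_measOp_of_raw` derive this from measurable `x`-sections of the raw species + measurable potential weights of the formats — one run,
  printed KIND) and its output read through the inclusion; the W1∕W4∕W3∕structure binders of the step of record TRANSFER to it (`operatorRate_onSub`, …);
* §2 **`termFamilyM`** — route P2's term family of record ON `M`: term data `(termData …).onSub M` (part 1 of the repair), inputs from `stepOnSub`;
  `readsStep_M` (6 × `rfl`), `realizes_M` (L02, hypothesis-free), `inBase_M` (L06 from `RefAt` at run B's input point of record, via `refAt_onSub`),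
  **`wellFormed_M`**: `WellFormed` from per-term admissible constants, the LATTICE part `GeometryCore` of the one-run geometry, measurable Gaussian
  coordinates of the cores, measurable potential weights of the formats, and `ReadLip` of the term data (restricted by `readLip_onSub`) — NO `hopm`
  over `ℓ^∞` any more: it is PROVED on `M` (`geometry_onSub_measOp`);
* §3 **`ne5_above_max_record_measOp`** — `∃ C₅, NE5 (outA 𝔖.toSlots E₀ cB) (outB 𝔖.toSlots E₀ cB) W κ θ′ C₅` with MI-R, L07, L08a∕b, L03-geometry,
  L09 ×2, the insertion structure and R-IDENT's window binders DISCHARGED as in parts A9∕A10, and the displayed list: L03 letters + window numerics,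
  `hadm`, **`hcore` (GeometryCore)**, `hlip`, measurability side conditions (`hXf`, `hBf`, `hFQ`, `hFR`, raw species `hrawQ∕hrawR` for both runs +
  format-boundedness), `hsum`, `RefAt` at both runs' own input points, W1∕W4∕W3 of the step of record, the transport reading, numerics.
  Every displayed binder is of printed KIND or numeric and — unlike the `Geometry` binder of A9–A11 (G-ne5p2-5) — none is refuted for realistic cores.
0 sorry; axioms ⊆ {propext, Classical.choice, Quot.sound}.
-/

noncomputable section

open MeasureTheory
open scoped BigOperators

namespace Summit.QuantumFields.BalabanUV.T4Continuum.B13KPStepTermMeasurable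

open Literature.MathematicalPhysics.QuantumFieldTheory.Balaban1983to89
open Literature.MathematicalPhysics.QuantumFieldTheory.Balaban1983to89.T4OutputRate (Carriers Functional DecayBound NE5)
open Literature.MathematicalPhysics.QuantumFieldTheory.Balaban1983to89.T4InputCauchyRateData (StepModel tableA tableB)
open Literature.MathematicalPhysics.QuantumFieldTheory.Balaban1983to89.T4ActivityLipschitz (ClusterRep)
open Literature.MathematicalPhysics.QuantumFieldTheory.Balaban1983to89.T4ActivityRecursion (InputModel KPInflated)
open Summit.QuantumFields.BalabanUV.T4Continuum.ActivityTermModel (TermDatum TermConsts TermFamily)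
open Summit.QuantumFields.BalabanUV.T4Continuum.ActivityStepJunction (ReadsStep)
open Summit.QuantumFields.BalabanUV.T4Continuum.B13Carriers (TwoRuns)
open Summit.QuantumFields.BalabanUV.T4Continuum.ClusterRepOfDomains (DomainGeometry)
open Summit.QuantumFields.BalabanUV.T4Continuum.B13DomainGeometryTR (domainGeometry clusterRep decayExtract_b13 pinBudget_b13 kpInflated_b13)
open Summit.QuantumFields.BalabanUV.T4Continuum.B13InnerData (b13InnerData Bnd)
open Summit.QuantumFields.BalabanUV.T4Continuum.B13OpDatum (Format OpDatum Species B13Weights FormatBounded)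
open Summit.QuantumFields.BalabanUV.T4Continuum.B13OpDatumJunctions (opOf)
open Summit.QuantumFields.BalabanUV.T4Continuum.B13HistMeasurable (MeasPotFrame B13HistM)
open Summit.QuantumFields.BalabanUV.T4Continuum.B13StepOfRecord (Slots step outA outB assembly structure_binders)
open Summit.QuantumFields.BalabanUV.T4Continuum.B13StepTermLabels (InnerLabel innerLabels)
open Summit.QuantumFields.BalabanUV.T4Continuum.B13OutKPFormRecord (LevelSummable ClusAbsConv)
open Summit.QuantumFields.BalabanUV.T4Continuum.B13KPStepOfRecord (outA_KP outB_KP rhoA rhoB inputA_KP inputB_KP represents_kp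
  ne5_above_max_record_of_kp)
open Summit.QuantumFields.BalabanUV.T4Continuum.B13TermData (TermCore termData)
open Summit.QuantumFields.BalabanUV.T4Continuum.B13StepOfRecordTermData (TermSlots)
open Summit.QuantumFields.BalabanUV.T4Continuum.B13KPStepTermWindow (window_of_majorant norm_act_le_size decayBoundA_of_baseMajorant
  outA_KP_of_not_transport)
open Summit.QuantumFields.BalabanUV.T4Continuum.B13OpMeasurable (measOp assemble_mem_measOp geometry_onSub_measOp)

variable {𝔾 : Type} [GaugeGroup 𝔾] {R : TwoRuns 𝔾} {P : MeasPotFrame R.carriers} {𝒴 : Type*} {dom : 𝒴 → R.carriers.Dom}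
  {T κ ι S Ω Ω₀ 𝒞 IOp : Type*} [MeasurableSpace Ω] [MeasurableSpace Ω₀] [Fintype ι] [Fintype κ] [DecidableEq ι] [DecidableEq κ]
  (𝔖 : TermSlots R P dom T κ ι S Ω Ω₀ 𝒞 IOp) (E₀ cB : ℝ)

/-! ## §1 The step of record on the measurable slot -/

/-- [folklore] **RUN B's OPERATOR DATA OF RECORD LIE IN THE MEASURABLE SLOT** when the raw species are format-bounded with measurable
`x`-sections on the potential species and the formats' potential weights are measurable in `x` (one-run side conditions, printed KIND). -/
theorem opB_mem_measOp_of_raw (hbd : ∀ g U k, FormatBounded (𝔖.F k) (𝔖.rawB g U k))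
    (hrawQ : ∀ g U k (Y : 𝒴) (b b' : κ), Measurable fun x : Ω => 𝔖.rawB g U k (.potQ x Y b b'))
    (hrawR : ∀ g U k (Y : 𝒴), Measurable fun x : Ω => 𝔖.rawB g U k (.potR x Y))
    (hFQ : ∀ k (Y : 𝒴) (b b' : κ), Measurable fun x : Ω => (𝔖.F k).wt (.potQ x Y b b'))
    (hFR : ∀ k (Y : 𝒴), Measurable fun x : Ω => (𝔖.F k).wt (.potR x Y)) (g : ℕ → ℝ) (U : R.carriers.BgB) (k : ℕ) :
    (step 𝔖.toSlots E₀ cB).opB g U k ∈ measOp T κ ι Ω 𝒴 :=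
  assemble_mem_measOp (𝔖.F k) (hbd g U k) (hrawQ g U k) (hrawR g U k) (hFQ k) (hFR k)

/-- [folklore] **RUN A's OPERATOR DATA OF RECORD (read at the transported background) LIE IN THE MEASURABLE SLOT** under the same
one-run side conditions on run A's raw species. -/
theorem opA_mem_measOp_of_raw (hbd : ∀ g V k, FormatBounded (𝔖.F k) (𝔖.rawA g V k))
    (hrawQ : ∀ g V k (Y : 𝒴) (b b' : κ), Measurable fun x : Ω => 𝔖.rawA g V k (.potQ x Y b b'))
    (hrawR : ∀ g V k (Y : 𝒴), Measurable fun x : Ω => 𝔖.rawA g V k (.potR x Y))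
    (hFQ : ∀ k (Y : 𝒴) (b b' : κ), Measurable fun x : Ω => (𝔖.F k).wt (.potQ x Y b b'))
    (hFR : ∀ k (Y : 𝒴), Measurable fun x : Ω => (𝔖.F k).wt (.potR x Y)) (g : ℕ → ℝ) (U : R.carriers.BgB) (k : ℕ) :
    (step 𝔖.toSlots E₀ cB).opA g U k ∈ measOp T κ ι Ω 𝒴 :=
  assemble_mem_measOp (𝔖.F k) (hbd g _ k) (hrawQ g _ k) (hrawR g _ k) (hFQ k) (hFR k)

variable (hA : ∀ g U k, (step 𝔖.toSlots E₀ cB).opA g U k ∈ measOp T κ ι Ω 𝒴)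
  (hB : ∀ g U k, (step 𝔖.toSlots E₀ cB).opB g U k ∈ measOp T κ ι Ω 𝒴)

/-- [folklore] **THE STEP OF RECORD ON THE MEASURABLE SLOT**: operator data coerced into `M`, the output read through the inclusion, insertions,
margins unchanged (base irrelevant for route P2's END: `univ`). -/
def stepOnSub : StepModel R.carriers (measOp T κ ι Ω 𝒴) (B13HistM P) where
  Out k o h X := (step 𝔖.toSlots E₀ cB).Out k o.1 h X
  opA g U k := ⟨(step 𝔖.toSlots E₀ cB).opA g U k, hA g U k⟩
  opB g U k := ⟨(step 𝔖.toSlots E₀ cB).opB g U k, hB g U k⟩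
  insA := (step 𝔖.toSlots E₀ cB).insA
  insB := (step 𝔖.toSlots E₀ cB).insB
  Base _ _ _ := Set.univ
  rOp := (step 𝔖.toSlots E₀ cB).rOp
  rHist := (step 𝔖.toSlots E₀ cB).rHist
  rOp_pos := (step 𝔖.toSlots E₀ cB).rOp_pos
  rHist_pos := (step 𝔖.toSlots E₀ cB).rHist_pos

/-- [folklore] **W1 TRANSFERS** to the step on the measurable slot (the inclusion is an isometry). -/
theorem operatorRate_onSub {W : Set (ℕ → ℝ)} {δ θ : ℝ} (h : (step 𝔖.toSlots E₀ cB).OperatorRate W δ θ) :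
    (stepOnSub 𝔖 E₀ cB hA hB).OperatorRate W δ θ := by
  intro k g hg U
  have e : ‖(stepOnSub 𝔖 E₀ cB hA hB).opA g U k - (stepOnSub 𝔖 E₀ cB hA hB).opB g U k‖ =
      ‖(step 𝔖.toSlots E₀ cB).opA g U k - (step 𝔖.toSlots E₀ cB).opB g U k‖ := by
    rw [Submodule.coe_norm, Submodule.coe_sub]; rfl
  rw [e]
  exact h k g hg U

/-- [folklore] **W4 TRANSFERS** (insertions unchanged). -/
theorem insertionRate_onSub {W : Set (ℕ → ℝ)} {κ' E₁ δ' θ : ℝ} (h : (step 𝔖.toSlots E₀ cB).InsertionRate W κ' E₁ δ' θ) :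
    (stepOnSub 𝔖 E₀ cB hA hB).InsertionRate W κ' E₁ δ' θ := h

/-- [folklore] **W3 TRANSFERS.** -/
theorem insScaleBound_onSub {W : Set (ℕ → ℝ)} {κ' E₁ c ω : ℝ} (h : (step 𝔖.toSlots E₀ cB).InsScaleBound W κ' E₁ c ω) :
    (stepOnSub 𝔖 E₀ cB hA hB).InsScaleBound W κ' E₁ c ω := h

/-- [folklore] The insertion structure transfers (`InsAffine`, `InsBlind`, `InsHomog` of the step of record, `structure_binders`). -/
theorem structure_onSub (W : Set (ℕ → ℝ)) :
    (stepOnSub 𝔖 E₀ cB hA hB).InsAffine W ∧ (stepOnSub 𝔖 E₀ cB hA hB).InsBlind W ∧ (stepOnSub 𝔖 E₀ cB hA hB).InsHomog W := by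
  obtain ⟨haff, hblind, hhom, -⟩ := structure_binders 𝔖.toSlots E₀ cB W
  exact ⟨haff, hblind, hhom⟩

/-! ## §2 Route P2's term family of record on the measurable slot -/

variable (𝔡 : R.carriers.Dom → InnerLabel R.carriers.Dom (Bnd R) → TermConsts)

/-- [folklore] **ROUTE P2's TERM FAMILY OF RECORD ON THE MEASURABLE SLOT**: term data `(termData …).onSub measOp`, inputs from `stepOnSub`. -/
def termFamilyM : TermFamily (clusterRep R (rhoA 𝔖.toSlots E₀ cB) (rhoB 𝔖.toSlots E₀ cB)) (measOp T κ ι Ω 𝒴) (B13HistM P) ι κ S Ω Ω₀ 𝒴 𝒞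
    (InnerLabel R.carriers.Dom (Bnd R)) where
  terms _ _ X Z := innerLabels (b13InnerData R) (R.carriers.scale X) Z
  𝔱 _ _ _ Z ℓ := (termData 𝔖.F 𝔖.G 𝔖.rHist 𝔖.core Z ℓ).onSub (measOp T κ ι Ω 𝒴)
  𝔠 _ _ _ Z ℓ := 𝔡 Z ℓ
  opA g U X := (stepOnSub 𝔖 E₀ cB hA hB).opA g U (R.carriers.scale X)
  opB g U X := (stepOnSub 𝔖 E₀ cB hA hB).opB g U (R.carriers.scale X)
  insA g U X := (step 𝔖.toSlots E₀ cB).insA g U (R.carriers.scale X)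
  insB g U X := (step 𝔖.toSlots E₀ cB).insB g U (R.carriers.scale X)
  ϱOp X := 𝔖.rOp (R.carriers.scale X)
  ϱHist X := 𝔖.rHist (R.carriers.scale X)
  ϱOp_pos _ := 𝔖.rOp_pos _
  ϱHist_pos _ := 𝔖.rHist_pos _

/-- [folklore] `ReadsStep` against the step on the measurable slot (six `rfl`s). -/
theorem readsStep_M : ReadsStep (termFamilyM 𝔖 E₀ cB hA hB 𝔡).model (stepOnSub 𝔖 E₀ cB hA hB) :=
  ActivityStepJunction.TermFamily.readsStep_model (termFamilyM 𝔖 E₀ cB hA hB 𝔡) (fun _ _ _ => rfl) (fun _ _ _ => rfl)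
    (fun _ _ _ _ => rfl) (fun _ _ _ _ => rfl) (fun _ => rfl) fun _ => rfl

/-- [folklore] **L02 ON THE MEASURABLE SLOT, hypothesis-free**: the term model's activities at the runs' own input points are the activity
families of record (`B13KPStepOfRecord.realizes_kp`, the terms being read through the inclusion). -/
theorem realizes_M (W : Set (ℕ → ℝ)) :
    (termFamilyM 𝔖 E₀ cB hA hB 𝔡).model.Realizes (outA_KP 𝔖.toSlots E₀ cB) (outB_KP 𝔖.toSlots E₀ cB) W :=
  B13KPStepOfRecord.realizes_kp 𝔖.toSlots E₀ cB W

/-- [folklore] **L06 ON THE MEASURABLE SLOT**: reference data for every term of record at run B's own input point of record give `InBase`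
(`refAt_onSub`). -/
theorem inBase_M {W : Set (ℕ → ℝ)}
    (hRef : ∀ g ∈ W, ∀ (U : R.carriers.BgB) (X : R.carriers.Dom),
      ∀ Z ∈ (domainGeometry R).level (R.carriers.scale X), ∀ ℓ ∈ innerLabels (b13InnerData R) (R.carriers.scale X) Z,
        (termData 𝔖.F 𝔖.G 𝔖.rHist 𝔖.core Z ℓ).RefAt (𝔡 Z ℓ) (inputB_KP 𝔖.toSlots E₀ cB g U X)) :
    (termFamilyM 𝔖 E₀ cB hA hB 𝔡).model.InBase (outB_KP 𝔖.toSlots E₀ cB) W :=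
  fun g hg U X Z hZ ℓ hℓ => (termData 𝔖.F 𝔖.G 𝔖.rHist 𝔖.core Z ℓ).refAt_onSub (measOp T κ ι Ω 𝒴) (hRef g hg U X Z hZ ℓ hℓ)

variable [DecidableEq 𝒞]

/-- [folklore] **`WellFormed` ON THE MEASURABLE SLOT — WITHOUT `hopm` OVER `ℓ^∞`.**  From per catalogued term of record: admissible constants
(`hadm`), the LATTICE part of the one-run geometry (`hcore : GeometryCore`), `ReadLip` of the term data at the margins of the term's scale
(`hlip`); and the measurability side conditions: Gaussian coordinates of the cores (`hXf`, `hBf`) and potential weights of the formats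
(`hFQ`, `hFR`).  The measurability fields of K6's `Geometry` are PROVED (`geometry_onSub_measOp`). -/
theorem wellFormed_M (W : Set (ℕ → ℝ))
    (hadm : ∀ k, ∀ Z ∈ (domainGeometry R).level k, ∀ ℓ ∈ innerLabels (b13InnerData R) k Z, (𝔡 Z ℓ).Admissible)
    (hcore : ∀ k, ∀ Z ∈ (domainGeometry R).level k, ∀ ℓ ∈ innerLabels (b13InnerData R) k Z,
      (termData 𝔖.F 𝔖.G 𝔖.rHist 𝔖.core Z ℓ).GeometryCore (𝔡 Z ℓ))
    (hlip : ∀ k, ∀ Z ∈ (domainGeometry R).level k, ∀ ℓ ∈ innerLabels (b13InnerData R) k Z,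
      (termData 𝔖.F 𝔖.G 𝔖.rHist 𝔖.core Z ℓ).ReadLip (𝔡 Z ℓ) (𝔖.rOp (R.carriers.scale Z)) (𝔖.rHist (R.carriers.scale Z)))
    (hXf : ∀ Z ℓ i, Measurable fun x => (𝔖.core Z ℓ).Xf x i) (hBf : ∀ Z ℓ a, Measurable fun x => (𝔖.core Z ℓ).Bf x a)
    (hFQ : ∀ k (Y : 𝒴) (b b' : κ), Measurable fun x : Ω => (𝔖.F k).wt (.potQ x Y b b'))
    (hFR : ∀ k (Y : 𝒴), Measurable fun x : Ω => (𝔖.F k).wt (.potR x Y)) :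
    (termFamilyM 𝔖 E₀ cB hA hB 𝔡).WellFormed W where
  hadm _ _ _ X Z hZ ℓ hℓ := hadm (R.carriers.scale X) Z hZ ℓ hℓ
  hgeo _ _ _ X Z hZ ℓ hℓ :=
    geometry_onSub_measOp (𝔖.core Z ℓ) (𝔖.F (R.carriers.scale Z)) (𝔖.G (R.carriers.scale Z)) (𝔖.rHist (R.carriers.scale Z))
      (hcore (R.carriers.scale X) Z hZ ℓ hℓ) (hXf Z ℓ) (hBf Z ℓ) (hFQ _) (hFR _)
  hlip _ _ _ X Z hZ ℓ hℓ := by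
    have hsc : R.carriers.scale Z = R.carriers.scale X := ((domainGeometry R).mem_level Z _).1 hZ
    have h := (termData 𝔖.F 𝔖.G 𝔖.rHist 𝔖.core Z ℓ).readLip_onSub (measOp T κ ι Ω 𝒴) (hlip (R.carriers.scale X) Z hZ ℓ hℓ)
    rw [hsc] at h
    exact h

/-- [folklore] **`WellFormed` ON THE MEASURABLE SLOT IN THE B13 FORMAT — `ReadLip` FROM THE INSTANCER's LETTERS, `hopm` PROVED.**  When the
step's entry formats are the B13 formats of its own weights (`𝔖.F k = (𝔖.G k).format`), `hlip` of `wellFormed_M` is DISCHARGED by part 2's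
`readLip_toTermDatum_signs` (no geometry binder) from `G.δ = 𝔡.δ`, the `𝐕″`-format domination and the margin inequalities; the B13 potential weights
are `x`-independent, so `hFQ`∕`hFR` hold by `measurable_const`.  Displayed: `hadm`, `GeometryCore`, the Gaussian coordinates' measurability, letters. -/
theorem wellFormed_M_of_format (W : Set (ℕ → ℝ)) (hF : ∀ k, 𝔖.F k = (𝔖.G k).format) {lamR : ℝ}
    (hadm : ∀ k, ∀ Z ∈ (domainGeometry R).level k, ∀ ℓ ∈ innerLabels (b13InnerData R) k Z, (𝔡 Z ℓ).Admissible)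
    (hcore : ∀ k, ∀ Z ∈ (domainGeometry R).level k, ∀ ℓ ∈ innerLabels (b13InnerData R) k Z,
      (termData 𝔖.F 𝔖.G 𝔖.rHist 𝔖.core Z ℓ).GeometryCore (𝔡 Z ℓ))
    (hXf : ∀ Z ℓ i, Measurable fun x => (𝔖.core Z ℓ).Xf x i) (hBf : ∀ Z ℓ a, Measurable fun x => (𝔖.core Z ℓ).Bf x a)
    (hδ : ∀ k, ∀ Z ∈ (domainGeometry R).level k, ∀ ℓ ∈ innerLabels (b13InnerData R) k Z, (𝔖.G k).δ = (𝔡 Z ℓ).δ)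
    (hvR : ∀ k, ∀ Z ∈ (domainGeometry R).level k, ∀ ℓ ∈ innerLabels (b13InnerData R) k Z, ∀ Y ∈ (𝔖.core Z ℓ).D,
      (𝔖.G k).v Y ≤ lamR * (𝔖.rHist k * (‖(𝔖.G k).τ Y‖ * B13HistDatum.level136 P.consts (R.carriers.d (dom Y)))))
    (hκL : ∀ k, ∀ Z ∈ (domainGeometry R).level k, ∀ ℓ ∈ innerLabels (b13InnerData R) k Z, 𝔖.rOp k ≤ (𝔡 Z ℓ).κL)
    (hκA : ∀ k, ∀ Z ∈ (domainGeometry R).level k, ∀ ℓ ∈ innerLabels (b13InnerData R) k Z, 𝔖.rOp k ≤ (𝔡 Z ℓ).κA)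
    (hκP : ∀ k, ∀ Z ∈ (domainGeometry R).level k, ∀ ℓ ∈ innerLabels (b13InnerData R) k Z, 𝔖.rOp k ≤ (𝔡 Z ℓ).κP)
    (hκQ : ∀ k, ∀ Z ∈ (domainGeometry R).level k, ∀ ℓ ∈ innerLabels (b13InnerData R) k Z, 𝔖.rOp k ≤ (𝔡 Z ℓ).κQ)
    (hκR : ∀ k, ∀ Z ∈ (domainGeometry R).level k, ∀ ℓ ∈ innerLabels (b13InnerData R) k Z, 𝔖.rOp k * lamR ≤ (𝔡 Z ℓ).κR) :
    (termFamilyM 𝔖 E₀ cB hA hB 𝔡).WellFormed W := by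
  have hFQ : ∀ k (Y : 𝒴) (b b' : κ), Measurable fun x : Ω => (𝔖.F k).wt (.potQ x Y b b') := fun k Y b b' => by
    simp only [hF k, B13Weights.format_wt, B13Weights.wt]; exact measurable_const
  have hFR : ∀ k (Y : 𝒴), Measurable fun x : Ω => (𝔖.F k).wt (.potR x Y) := fun k Y => by
    simp only [hF k, B13Weights.format_wt, B13Weights.wt]; exact measurable_const
  refine wellFormed_M 𝔖 E₀ cB hA hB 𝔡 W hadm hcore (fun k Z hZ ℓ hℓ => ?_) hXf hBf hFQ hFR
  have hsc : R.carriers.scale Z = k := ((domainGeometry R).mem_level Z _).1 hZ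
  unfold termData
  rw [hsc, hF k]
  exact B13OpMeasurable.readLip_toTermDatum_signs (𝔖.core Z ℓ) (𝔖.G k) (𝔖.rHist k) (𝔡 Z ℓ) (hδ k Z hZ ℓ hℓ) (hvR k Z hZ ℓ hℓ)
    (𝔖.rOp_pos k) (𝔖.rHist_pos k) (hκL k Z hZ ℓ hℓ) (hκA k Z hZ ℓ hℓ) (hκP k Z hZ ℓ hℓ) (hκQ k Z hZ ℓ hℓ) (hκR k Z hZ ℓ hℓ)

omit [DecidableEq 𝒞] in
/-- [folklore] At a point carrying reference data for every catalogued term (admissible constants), the activities of record are under the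
per-term majorants `G` of the family on the measurable slot (sizes ≤ `G`, amplitudes nonnegative) — the hypothesis of `window_of_majorant`. -/
theorem actNorm_le_majorant_M {W : Set (ℕ → ℝ)} {m : (ℕ → ℝ) → R.carriers.BgB → R.carriers.Dom → ℝ} {Λop Λhist ρ₀ A_m R_m : ℝ}
    (hΛop : 0 < Λop) (hΛhist : 0 < Λhist)
    (hadm : ∀ k, ∀ Z ∈ (domainGeometry R).level k, ∀ ℓ ∈ innerLabels (b13InnerData R) k Z, (𝔡 Z ℓ).Admissible)
    (hsum : ∀ g ∈ W, ∀ (U : R.carriers.BgB) (X : R.carriers.Dom), ∀ Z ∈ (domainGeometry R).level (R.carriers.scale X),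
      ∑ ℓ ∈ innerLabels (b13InnerData R) (R.carriers.scale X) Z, (termFamilyM 𝔖 E₀ cB hA hB 𝔡).G Λop Λhist ρ₀ g U X Z ℓ ≤ m g U Z)
    (hm : ∀ g ∈ W, ∀ (U : R.carriers.BgB) (k : ℕ), ∀ Z ∈ R.domAt k, m g U Z ≤ A_m * Real.exp (-(R_m * R.carriers.d Z)))
    {g : ℕ → ℝ} (hg : g ∈ W) (U : R.carriers.BgB) (X : R.carriers.Dom) {q : OpDatum (Species T κ ι Ω 𝒴) × B13HistM P}
    (hRef : ∀ Z ∈ (domainGeometry R).level (R.carriers.scale X), ∀ ℓ ∈ innerLabels (b13InnerData R) (R.carriers.scale X) Z,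
      (termData 𝔖.F 𝔖.G 𝔖.rHist 𝔖.core Z ℓ).RefAt (𝔡 Z ℓ) q) :
    ∀ Z ∈ (domainGeometry R).level (R.carriers.scale X),
      ∑ ℓ ∈ innerLabels (b13InnerData R) (R.carriers.scale X) Z, ‖𝔖.toSlots.act Z ℓ q.1 q.2‖ ≤ A_m * Real.exp (-(R_m * R.carriers.d Z)) := by
  intro Z hZ
  refine le_trans (Finset.sum_le_sum fun ℓ hℓ => ?_) ((hsum g hg U X Z hZ).trans (hm g hg U (R.carriers.scale X) Z hZ))
  have had : (𝔡 Z ℓ).Admissible := hadm _ Z hZ ℓ hℓ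
  obtain ⟨hAop, hAh, -⟩ := (termData 𝔖.F 𝔖.G 𝔖.rHist 𝔖.core Z ℓ).amp_nonneg (𝔡 Z ℓ) had ρ₀
  have h1 := norm_act_le_size 𝔖 had (hRef Z hZ ℓ hℓ)
  show ‖𝔖.toSlots.act Z ℓ q.1 q.2‖ ≤ (𝔡 Z ℓ).size
    + (termData 𝔖.F 𝔖.G 𝔖.rHist 𝔖.core Z ℓ).ampOp (𝔡 Z ℓ) ρ₀ / Λop
    + (termData 𝔖.F 𝔖.G 𝔖.rHist 𝔖.core Z ℓ).ampHist (𝔡 Z ℓ) ρ₀ / Λhist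
  have := div_nonneg hAop hΛop.le
  have := div_nonneg hAh hΛhist.le
  linarith

/-! ## §3 The END on the holder's functionals of record, every displayed binder satisfiable in principle -/

/-- [folklore] **ROUTE P2's END ON BAŁABAN's CARRIERS OF RECORD, RUN ON THE MEASURABLE OPERATOR SLOT** (repair R-b of G-ne5p2-5).  Same
composition as `B13KPStepTermWindow.ne5_above_max_record_termModel_levels` (K7's END-T for `termFamilyM` reading `stepOnSub`; MI-R, L07, L08a∕b,
L03-geometry, L09 ×2, the insertion structure, R-IDENT's window binders DISCHARGED), with the well-formedness binder ASSEMBLED from satisfiable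
pieces: `hadm`, **`hcore : GeometryCore`** (lattice sums, weights, pins, input-free measurabilities — printed KIND), `hlip`, and the measurability
side conditions `hXf`∕`hBf` (Gaussian coordinates of the cores), `hFQ`∕`hFR` (potential weights of the formats), `hA`∕`hB` (the operator data of
record lie in the measurable slot — from `opA_mem_measOp_of_raw`∕`opB_mem_measOp_of_raw`).  Also displayed: L03 letters + window numerics, `hsum`,
`RefAt` of every term of record at BOTH runs' own input points (L06), W1 `OperatorRate` ∕ W4 `InsertionRate` (level `64τe^{−5σ}`) ∕ W3
`InsScaleBound` of the step of record, the transport reading, numerics.  Conclusion `∃ C₅, NE5 (outA 𝔖.toSlots E₀ cB) (outB 𝔖.toSlots E₀ cB) W ϰ θ′ C₅` (the NE5 decay rate is written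
`ϰ` here, `κ` being the bond-site type).  NOT a proof of NE5; cores and constants are NAMED PARAMETERS. -/
theorem ne5_above_max_record_measOp (hT : (assembly 𝔖.toSlots).TransportReads Set.univ) {W : Set (ℕ → ℝ)}
    {m : (ℕ → ℝ) → R.carriers.BgB → R.carriers.Dom → ℝ}
    {A_m R_m τ σ s E₁ ϰ θ δ δ' c ω Λop Λhist ρ₀ ρ₀' : ℝ}
    -- L03 in letters + the two window numerics
    (hA_m : 0 ≤ A_m) (hτ : 0 ≤ τ) (hσ : 0 ≤ σ) (hs0 : 0 ≤ s)
    (hm0 : ∀ (g : ℕ → ℝ) (U : R.carriers.BgB) (Z : R.carriers.Dom), 0 ≤ m g U Z)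
    (hm : ∀ g ∈ W, ∀ (U : R.carriers.BgB) (k : ℕ), ∀ Z ∈ R.domAt k, m g U Z ≤ A_m * Real.exp (-(R_m * R.carriers.d Z)))
    (hrate : 64 * Real.log 162 + σ + τ * 64 ≤ R_m)
    (hsmall : (1 + s) * A_m * Real.exp (σ * 5 + τ * 64) * B12TreeDecay.K₀ (4 * 2 ^ 4) (2 * 4) * 9 ≤ τ) (hσκ : ϰ + 1 ≤ σ)
    (hrate' : 64 * Real.log 162 + 64 ≤ R_m) (hsmall' : 36 * (A_m * Real.exp 64 * B12TreeDecay.K₀ (4 * 2 ^ 4) (2 * 4)) < 1)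
    -- L04∕L05 per catalogued term of record: admissible constants, LATTICE geometry, read-out Lipschitz structure; measurability side conditions
    (hadm : ∀ k, ∀ Z ∈ (domainGeometry R).level k, ∀ ℓ ∈ innerLabels (b13InnerData R) k Z, (𝔡 Z ℓ).Admissible)
    (hcore : ∀ k, ∀ Z ∈ (domainGeometry R).level k, ∀ ℓ ∈ innerLabels (b13InnerData R) k Z,
      (termData 𝔖.F 𝔖.G 𝔖.rHist 𝔖.core Z ℓ).GeometryCore (𝔡 Z ℓ))
    (hlip : ∀ k, ∀ Z ∈ (domainGeometry R).level k, ∀ ℓ ∈ innerLabels (b13InnerData R) k Z,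
      (termData 𝔖.F 𝔖.G 𝔖.rHist 𝔖.core Z ℓ).ReadLip (𝔡 Z ℓ) (𝔖.rOp (R.carriers.scale Z)) (𝔖.rHist (R.carriers.scale Z)))
    (hXf : ∀ Z ℓ i, Measurable fun x => (𝔖.core Z ℓ).Xf x i) (hBf : ∀ Z ℓ a, Measurable fun x => (𝔖.core Z ℓ).Bf x a)
    (hFQ : ∀ k (Y : 𝒴) (b b' : κ), Measurable fun x : Ω => (𝔖.F k).wt (.potQ x Y b b'))
    (hFR : ∀ k (Y : 𝒴), Measurable fun x : Ω => (𝔖.F k).wt (.potR x Y))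
    -- L03-dom
    (hsum : ∀ g ∈ W, ∀ (U : R.carriers.BgB) (X : R.carriers.Dom), ∀ Z ∈ (domainGeometry R).level (R.carriers.scale X),
      ∑ ℓ ∈ innerLabels (b13InnerData R) (R.carriers.scale X) Z, (termFamilyM 𝔖 E₀ cB hA hB 𝔡).G Λop Λhist ρ₀ g U X Z ℓ ≤ m g U Z)
    (hρ₁ : ρ₀ ≤ 1)
    -- L06 at BOTH runs' own input points of record
    (hRef : ∀ g ∈ W, ∀ (U : R.carriers.BgB) (X : R.carriers.Dom),
      ∀ Z ∈ (domainGeometry R).level (R.carriers.scale X), ∀ ℓ ∈ innerLabels (b13InnerData R) (R.carriers.scale X) Z,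
        (termData 𝔖.F 𝔖.G 𝔖.rHist 𝔖.core Z ℓ).RefAt (𝔡 Z ℓ) (inputB_KP 𝔖.toSlots E₀ cB g U X))
    (hRefA : ∀ g ∈ W, ∀ (U : R.carriers.BgB) (X : R.carriers.Dom),
      ∀ Z ∈ (domainGeometry R).level (R.carriers.scale X), ∀ ℓ ∈ innerLabels (b13InnerData R) (R.carriers.scale X) Z,
        (termData 𝔖.F 𝔖.G 𝔖.rHist 𝔖.core Z ℓ).RefAt (𝔡 Z ℓ) (inputA_KP 𝔖.toSlots E₀ cB g U X))
    -- W1, W4, W3 of the step of record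
    (hop : (step 𝔖.toSlots E₀ cB).OperatorRate W δ θ)
    (hins : (step 𝔖.toSlots E₀ cB).InsertionRate W ϰ (τ * 64 * Real.exp (-(σ * 5))) δ' θ)
    (hunit : (step 𝔖.toSlots E₀ cB).InsScaleBound W ϰ E₁ c ω)
    -- numerics
    (hE₁ : 0 < E₁) (hΛop : 0 < Λop) (hΛhist : 0 < Λhist) (hρ : max (Λhist / Λop) 1 * ρ₀' ≤ ρ₀)
    (hs : Λhist * ρ₀' < s) (hδ : 0 ≤ δ) (hδ' : 0 ≤ δ') (hθ : 0 ≤ θ) (hθ1 : θ < 1)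
    (hc : 0 ≤ c) (hω : 0 < ω) (hω1 : ω < 1)
    (hreach : c * (τ * 64 * Real.exp (-(σ * 5)) + τ * 64 * Real.exp (-(σ * 5))) / (1 - ω) < ρ₀')
    {θ' : ℝ} (hθ' : max θ (ω + (τ * 64 * Real.exp (-(σ * 5))) * Λhist / (s - Λhist * ρ₀') * c) < θ') :
    ∃ C₅, NE5 (outA 𝔖.toSlots E₀ cB) (outB 𝔖.toSlots E₀ cB) W ϰ θ' C₅ := by
  have hwf := wellFormed_M 𝔖 E₀ cB hA hB 𝔡 W hadm hcore hlip hXf hBf hFQ hFR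
  have hrep := represents_kp 𝔖.toSlots E₀ cB hT
  have hreal := realizes_M 𝔖 E₀ cB hA hB 𝔡 W
  have hbase := inBase_M 𝔖 E₀ cB hA hB 𝔡 hRef
  have hmaj := (termFamilyM 𝔖 E₀ cB hA hB 𝔡).baseMajorant_model hwf hΛop hΛhist hsum
  have hKP := kpInflated_b13 (rhoA 𝔖.toSlots E₀ cB) (rhoB 𝔖.toSlots E₀ cB) hA_m hτ hσ hs0 hm0 hm hrate hsmall
  have hdec := decayExtract_b13 (rhoA 𝔖.toSlots E₀ cB) (rhoB 𝔖.toSlots E₀ cB) hσ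
  have hpin := pinBudget_b13 (rhoA 𝔖.toSlots E₀ cB) (rhoB 𝔖.toSlots E₀ cB) hτ hσκ
  -- the two levels (L09) at the derived level `64τe^{−5σ}`
  have hdB : DecayBound (outB_KP 𝔖.toSlots E₀ cB) W (τ * 64 * Real.exp (-(σ * 5))) ϰ :=
    (termFamilyM 𝔖 E₀ cB hA hB 𝔡).model.decayBound_of_baseMajorant hrep hreal hbase hmaj hKP hs0 hdec hpin
  have hdA : DecayBound (outA_KP 𝔖.toSlots E₀ cB) W (τ * 64 * Real.exp (-(σ * 5))) ϰ :=
    decayBoundA_of_baseMajorant (termFamilyM 𝔖 E₀ cB hA hB 𝔡).model hrep hreal (fun g hg U X Z hZ ℓ hℓ =>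
      (termData 𝔖.F 𝔖.G 𝔖.rHist 𝔖.core Z ℓ).refAt_onSub (measOp T κ ι Ω 𝒴) (hRefA g hg U X Z hZ ℓ hℓ)) hmaj hKP hs0 hdec hpin
      (by positivity) fun g _ V hV X => outA_KP_of_not_transport 𝔖.toSlots E₀ cB hV X
  -- R-IDENT's window binders at both runs' input points
  have hwinA : ∀ g ∈ W, ∀ (U : R.carriers.BgB) (X : R.carriers.Dom),
      LevelSummable 𝔖.toSlots X (inputA_KP 𝔖.toSlots E₀ cB g U X) ∧ ClusAbsConv 𝔖.toSlots X (inputA_KP 𝔖.toSlots E₀ cB g U X) :=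
    fun g hg U X => window_of_majorant 𝔖.toSlots hA_m
      (actNorm_le_majorant_M 𝔖 E₀ cB hA hB 𝔡 hΛop hΛhist hadm hsum hm hg U X (hRefA g hg U X)) hrate' hsmall'
  have hwinB : ∀ g ∈ W, ∀ (U : R.carriers.BgB) (X : R.carriers.Dom),
      LevelSummable 𝔖.toSlots X (inputB_KP 𝔖.toSlots E₀ cB g U X) ∧ ClusAbsConv 𝔖.toSlots X (inputB_KP 𝔖.toSlots E₀ cB g U X) :=
    fun g hg U X => window_of_majorant 𝔖.toSlots hA_m
      (actNorm_le_majorant_M 𝔖 E₀ cB hA hB 𝔡 hΛop hΛhist hadm hsum hm hg U X (hRef g hg U X)) hrate' hsmall'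
  obtain ⟨haffN, hblindN, hhomN⟩ := structure_onSub 𝔖 E₀ cB hA hB W
  refine ne5_above_max_record_of_kp 𝔖.toSlots E₀ cB hT (fun g hg U X => (hwinA g hg U X).1) (fun g hg U X => (hwinA g hg U X).2)
    (fun g hg U X => (hwinB g hg U X).1) (fun g hg U X => (hwinB g hg U X).2) ?_
  exact ActivityStepJunction.TermFamily.ne5_above_max_of_model_reach_step (termFamilyM 𝔖 E₀ cB hA hB 𝔡)
    (readsStep_M 𝔖 E₀ cB hA hB 𝔡) hwf hsum hρ₁ hrep hreal hbase hKP hdec hpin hdA hdB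
    (operatorRate_onSub 𝔖 E₀ cB hA hB hop) (insertionRate_onSub 𝔖 E₀ cB hA hB hins) haffN hblindN hhomN
    (insScaleBound_onSub 𝔖 E₀ cB hA hB hunit) hE₁ (by positivity) hΛop hΛhist hρ hs hδ hδ' hθ hθ1 hc hω hω1 hreach hθ'

end Summit.QuantumFields.BalabanUV.T4Continuum.B13KPStepTermMeasurable

end
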